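import Literature.NumberTheory.Automorphic.HyperspecialUnitarySatakeTransformAdicCompletion     -- ★ `unitaryHeckeEigencharacterAdic`, `_eq`, `unramifiedLocalConjDatum_localConjUniformizer`
import Literature.NumberTheory.Automorphic.HyperspecialUnitarySatakeIsomorphismAdicCompletion   -- ★ brings `exists_galAdicCompletionMap_ne` (`σ_w ≠ id`)
import Literature.NumberTheory.Automorphic.UnitaryRankOneUnramifiedCharacters                    -- ★ `exists_generator_three∕two` (`ℋ = ℂ[T₁]`), `heckeEigencharacter_apply_generator`
import HarnessLib

/-!
# R90-TF · S6 (Ch. 14.1–5 stable TF) · WAVE 3 (a) — the SATAKE-GRAPH PARTNER EXISTS at an inert unramified place: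
# for every `φ ∈ ℋ(U(J₀,3)(E_w), K₀)` there is `φ^H ∈ ℋ(U(J₀,2)(E_w), K₀)` with `λ^{(2)}_{(z,1)}(φ^H) = λ^{(3)}_{(−z,1,1)}(φ)` for all `z ∈ ℂˣ`

Cell `hodgecm-mathlib`, crux H413 (`stmt-HodgeConjecture-24833`), route of record `HCCMUnconditional`; programme R90-TF (brief `director/R90-BRIEF.v2.md`
1f40d54518340a35), section S6 = Rogawski Ch. 14.1–5 (base `R90-C14`, dealer R90-C14-plan (g0)), hand W3-a (DEAL 2026-09-04T16:46:28Z via LEAD #28) to seat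
R90-C131-p04 (g0); sheet `R90/R90-C14-plan/g0/S6_wave3_targets.v1.R90-C14-plan-g0.lean` (sha16 17c4113e7673ca44) :27–:35, signature TOKEN-IDENTICAL (namespace
`…R90.S6`, the sheet's `.Wave3` dropped).  Supply lemma for `Cruxes/H413/Lines/R90_S6_FloorE1D.lean` § (E1-c) `SatakeGraph` and the S6 ED. 2b Hecke
variation.  Lane `--supports stmt-HodgeConjecture-24833 --as helper`; ONE theorem, ★-only imports (Literature), no definition, no instance, no notation, no `sorry`.

PRINT.  [Rogawski1990, §4.5 p. 55]: the map `f ↦ ξ̂_H(f)` of unramified Hecke algebras with `ξ̂_H(f)^∧(z) = f^∧(−z)` (the Satake transforms read on the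
rank-one parameter line; the sign is the unramified character `μ` with `μ(ϖ) = −1` entering `ξ_H`).  [CartierCorvallis1979, §IV Thm. 4.1, Cor. 4.2]: `ℋ(G,K) ≅ ℂ[Λ]^W`
is a polynomial algebra; for `U(3)` and `U(2)` at an inert place it is `ℂ[T₁]` in ONE Hecke operator and `λ_β(T₁) = z(β) + z(β)⁻¹` with `z(β) = β₀ β₂⁻¹`
resp. `β₀ β₁⁻¹`.

PROOF (the «`ℋ = ℂ[T₁]`» road of ★ `UnitaryRankOneUnramifiedCharacters`, no coefficient bookkeeping).  Let `T₁^{(3)}, T₁^{(2)}` be the generators (★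
`exists_generator_three∕two` at the datum of ★ `unramifiedLocalConjDatum_localConjUniformizer`, `σ_w ≠ id` by ★ `exists_galAdicCompletionMap_ne`), and write
`φ = P(T₁^{(3)})`.  Put **`φ^H := P(−T₁^{(2)})`** (`aeval T₁^{(2)} (P.comp (−X))`).  Eigencharacters are algebra homomorphisms, so
`λ^{(2)}_{(z,1)}(φ^H) = P(−(z + z⁻¹))` and `λ^{(3)}_{(−z,1,1)}(φ) = P((−z) + (−z)⁻¹) = P(−(z + z⁻¹))` (★ `heckeEigencharacter_apply_generator`:
`z((z,1)) = z`, `z((−z,1,1)) = −z`).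

HONEST LABEL: HC_CM is proved only modulo the 7 printed citations (2 remaining named inputs: hLiu418 = stmt-HodgeConjecture-24832, h413 = stmt-HodgeConjecture-24833)
until rung 0 closes; this file is unconditional local Hecke algebra and discharges no citation by itself.  REL ≠ ★ ≠ BUILT.

## References
* [Rogawski1990] J. D. Rogawski, *Automorphic Representations of Unitary Groups in Three Variables*, Ann. of Math. Stud. 123 (1990), §4.5 p. 55 (`ξ̂_H(f)^∧(z) = f^∧(−z)`),
  §4.5 p. 50 (unramified `λ_β`).
* [CartierCorvallis1979] P. Cartier, *Representations of 𝔭-adic groups: a survey*, PSPM 33.1 (1979), §IV Thm. 4.1, Cor. 4.2, (4.2)–(4.4).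
* [Minguez2011] A. Mínguez, *Unramified representations of unitary groups*, in *On the stabilization of the trace formula* (2011), §4.
-/

set_option autoImplicit false
set_option linter.dupNamespace false

noncomputable section

open scoped Valued WithZero Matrix MatrixGroups
open Polynomial
open NumberField IsDedekindDomain
open Literature.NumberTheory.Automorphic Literature.NumberTheory.Automorphic.HermitianLattice Literature.NumberTheory.Automorphic.UnitaryGroup

namespace Summit.HodgeConjecture.HodgeConjecture.R90.S6

variable {F E : Type} [Field F] [NumberField F] [Field E] [NumberField E] [Algebra F E] [Algebra.IsQuadraticExtension F E]
  (c : E ≃ₐ[F] E) (hc1 : c ≠ 1) (v : HeightOneSpectrum (𝓞 F)) (w : PlacesOver E v) (hw : c • w.1 = w.1)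
  (hv : Algebra.IsUnramifiedIn (𝓞 E) v.asIdeal)

-- (the sheet's `heckeAlgebra` carrier at `E_w` and the generic-`K` carrier of ★ `UnitaryRankOneUnramifiedCharacters` agree only up to
--  instance-path unfolding; each such unification is costly, whence the raised heartbeat budget — no `decide`, no search)
set_option maxHeartbeats 800000 in
/-- **W3-a (existence): the Satake-graph partner `φ ↦ φ^H` exists** — for every `φ ∈ ℋ(U(J₀,3)(E_w), K₀)` there is
`φ^H ∈ ℋ(U(J₀,2)(E_w), K₀)` with `λ^{(2)}_{(z,1)}(φ^H) = λ^{(3)}_{(−z,1,1)}(φ)` for every `z ∈ ℂˣ` (print's `ξ̂_H(f)^∧(z) = f^∧(−z)`): with `φ = P(T₁^{(3)})`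
in the one-generator algebra `ℋ₃ = ℂ[T₁^{(3)}]`, take `φ^H := P(−T₁^{(2)})`; both sides equal `P(−(z + z⁻¹))`.  Signature = sheet 17c4113e7673ca44 :27–:35.
[cite: Rogawski1990, §4.5 p. 55] [cite: CartierCorvallis1979, §IV Thm. 4.1, Cor. 4.2] -/
theorem satakeGraph_partner_exists
    (φ : heckeAlgebra ℂ ↥(unitaryGroupOfForm (galAdicCompletionMap (L := E) c hw) ((StdForm.antidiagonal 3).over (w.1.adicCompletion E)))
      (unitaryInt (galAdicCompletionMap (L := E) c hw) ((StdForm.antidiagonal 3).over (w.1.adicCompletion E)))) :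
    ∃ φH : heckeAlgebra ℂ ↥(unitaryGroupOfForm (galAdicCompletionMap (L := E) c hw) ((StdForm.antidiagonal 2).over (w.1.adicCompletion E)))
        (unitaryInt (galAdicCompletionMap (L := E) c hw) ((StdForm.antidiagonal 2).over (w.1.adicCompletion E))),
      ∀ z : ℂˣ, unitaryHeckeEigencharacterAdic c hc1 v w hw hv ![z, 1] φH =
        unitaryHeckeEigencharacterAdic c hc1 v w hw hv ![-z, 1, 1] φ := by
  haveI := finite_residueField_adicCompletion E w.1
  haveI := isHeckeTriple_unitaryInt_adicCompletion c v w hw ((StdForm.antidiagonal 3).over (w.1.adicCompletion E))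
  haveI := isHeckeTriple_unitaryInt_adicCompletion c v w hw ((StdForm.antidiagonal 2).over (w.1.adicCompletion E))
  have hσ : ∃ x : w.1.adicCompletion E, galAdicCompletionMap (L := E) c hw x ≠ x := exists_galAdicCompletionMap_ne c hc1 v w hw
  have hd : UnramifiedLocalConjDatum (galAdicCompletionMap (L := E) c hw) (localConjUniformizer c hc1 v w hw hv) :=
    unramifiedLocalConjDatum_localConjUniformizer c hc1 v w hw hv
  -- the two one-generator presentations `ℋ₃ = ℂ[T₃]`, `ℋ₂ = ℂ[T₂]`
  obtain ⟨T₃, hT₃, hgen₃⟩ := hd.exists_generator_three hσ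
  obtain ⟨T₂, hT₂, -⟩ := hd.exists_generator_two hσ
  have hφ := hgen₃ φ   -- (`have` first: elaborating `hgen₃ φ` inside `obtain` triggers a costly instance-path unification)
  obtain ⟨P, hP⟩ := hφ
  -- the lines are additive (for `λ_β(T₁) = z(β) + z(β)⁻¹`)
  have hadd₃ : ∀ a b : ℤ, (fun i : Fin 3 => (a + b) * (1 - (i : ℕ) : ℤ)) =
      (fun i : Fin 3 => a * (1 - (i : ℕ) : ℤ)) + fun i : Fin 3 => b * (1 - (i : ℕ) : ℤ) := by
    intro a b; funext i; simp only [Pi.add_apply]; ring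
  have hadd₂ : ∀ a b : ℤ, (fun i : Fin 2 => (a + b) * (1 - 2 * (i : ℕ) : ℤ)) =
      (fun i : Fin 2 => a * (1 - 2 * (i : ℕ) : ℤ)) + fun i : Fin 2 => b * (1 - 2 * (i : ℕ) : ℤ) := by
    intro a b; funext i; simp only [Pi.add_apply]; ring
  -- the Satake parameters on the two lines: `z((z,1)) = z`, `z((−z,1,1)) = −z`
  have hz₂ : ∀ z : ℂˣ, (∏ i : Fin 2, (((![z, 1] : Fin 2 → ℂˣ) i : ℂ) ^ ((fun m (i : Fin 2) => m * (1 - 2 * (i : ℕ) : ℤ)) 1 i))) = (z : ℂ) := by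
    intro z
    rw [Fin.prod_univ_two]
    simp only [Matrix.cons_val_zero, Matrix.cons_val_one, Fin.val_zero, Fin.val_one, Nat.cast_zero, Nat.cast_one,
      mul_zero, sub_zero, mul_one, one_mul, Units.val_one, one_zpow, zpow_one]
  have hz₃ : ∀ z : ℂˣ, (∏ i : Fin 3, (((![-z, 1, 1] : Fin 3 → ℂˣ) i : ℂ) ^ ((fun m (i : Fin 3) => m * (1 - (i : ℕ) : ℤ)) 1 i))) = -(z : ℂ) := by
    intro z
    rw [Fin.prod_univ_three]
    simp only [Matrix.cons_val_zero, Matrix.cons_val_one, Matrix.cons_val_two, Matrix.tail_cons, Matrix.head_cons, Fin.val_zero, Fin.val_one,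
      Fin.val_two, Nat.cast_zero, Nat.cast_one, Nat.cast_ofNat, sub_zero, sub_self, one_mul, mul_zero, Units.val_one, one_zpow, zpow_one,
      zpow_zero, mul_one, Units.val_neg]
  refine ⟨aeval T₂ (P.comp (-X)), fun z => ?_⟩
  -- eigencharacters are algebra homomorphisms: evaluate on the generator
  have e₂ : unitaryHeckeEigencharacterAdic c hc1 v w hw hv ![z, 1] (aeval T₂ (P.comp (-X))) =
      aeval (hd.heckeEigencharacter ![z, 1] T₂) (P.comp (-X)) := by
    rw [unitaryHeckeEigencharacterAdic_eq c hc1 v w hw hv hd]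
    exact (aeval_algHom_apply (hd.heckeEigencharacter ![z, 1]) T₂ (P.comp (-X))).symm
  have e₃ : unitaryHeckeEigencharacterAdic c hc1 v w hw hv ![-z, 1, 1] φ =
      aeval (hd.heckeEigencharacter ![-z, 1, 1] T₃) P := by
    rw [unitaryHeckeEigencharacterAdic_eq c hc1 v w hw hv hd, ← hP]
    exact (aeval_algHom_apply (hd.heckeEigencharacter ![-z, 1, 1]) T₃ P).symm
  rw [e₂, e₃, hd.heckeEigencharacter_apply_generator (ℓ := fun m (i : Fin 2) => (m * (1 - 2 * (i : ℕ)) : ℤ)) hadd₂ hT₂,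
    hd.heckeEigencharacter_apply_generator (ℓ := fun m (i : Fin 3) => (m * (1 - (i : ℕ)) : ℤ)) hadd₃ hT₃, hz₂, hz₃,
    aeval_comp, map_neg, aeval_X]
  congr 1
  rw [neg_add, inv_neg]

end Summit.HodgeConjecture.HodgeConjecture.R90.S6

end
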